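import Literature.Probability.Percolation.CutBlocksFaceFar
import HarnessLib

/-!
# Wall faces of the zones of a cut: the lower, right and left faces

Topic `Probability/Percolation`.  Support file (proofs, no named fact) for the named fact
`SchrammSmirnov2011_thm_1_7` (the landing count of the proof of Prop. 4.1, Ann. Probab. 39 (2011),
§4): the two hypotheses of the face bound `real_badFace_le` — clean windows fitting in the face
columns, far sites at distance `≥ s/δ - 1` — for the LOWER, RIGHT and LEFT wall faces of
`CutBlocks.zones`, transported from the upper faces (`CutBlocksFaceFar.lean`) of the reflected /
transposed cut by the equivariance of the zones (`mem_Far_reflect`, `mem_Far_swap`,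
`collar_map_reflY`, `collar_map_swap`).  Frames: `reflY.trans (downShift s δ (-z₂-1))` (lower),
`swap.trans (downShift s δ z₁)` (right), `swap.trans (reflY.trans (downShift s δ (-z₁-1)))` (left);
face columns `[faceA, faceB]` of `z₁` (lower) and of `z₂` (right, left).

## References

* O. Schramm, S. Smirnov, *On the scaling limits of planar percolation*, Ann. Probab. 39 (2011)
  1768–1814, arXiv:1101.5820, §4, proof of Prop. 4.1. [SchrammSmirnov2011]
-/

noncomputable section

open Set Metric
open Literature.Probability.LatticeModels
open scoped ComplexConjugate

namespace Literature.Probability.Percolation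

namespace CutBlocks

open SSContinuity (swapC)

variable {s : ℝ} {α : Set ℂ} {δ : ℝ}

/-- **Far sites of the reflected cut.** [folklore] -/
theorem mem_Far_reflect (hs : 0 < s) (hδ : 0 < δ) (hα : Bornology.IsBounded α) {v : Site 2} :
    Seeded.LatticeSym.reflYSite v ∈ (zones (α := conj '' α) hs hδ (isBounded_conj hα)).Far ↔ v ∈ (zones hs hδ hα).Far := by
  simp only [Seeded.Zones.Far, mem_setOf_eq, zones_SQ, Finset.notMem_empty, not_false_eq_true, and_true]
  rw [mem_zones_K, mem_zones_N, mem_zones_K, mem_zones_N, mem_Kset_reflect, mem_Nset_reflect]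

/-- **Far sites of the transposed cut.** [folklore] -/
theorem mem_Far_swap (hs : 0 < s) (hδ : 0 < δ) (hα : Bornology.IsBounded α) {v : Site 2} :
    Seeded.LatticeSym.swapSite v ∈ (zones (α := swapC '' α) hs hδ (isBounded_swapC hα)).Far ↔ v ∈ (zones hs hδ hα).Far := by
  simp only [Seeded.Zones.Far, mem_setOf_eq, zones_SQ, Finset.notMem_empty, not_false_eq_true, and_true]
  rw [mem_zones_K, mem_zones_N, mem_zones_K, mem_zones_N, mem_Kset_swap, mem_Nset_swap]

/-! ### Lower faces -/

/-- **Clean windows fitting in a lower face.** [cite: SchrammSmirnov2011, §4, proof of Prop. 4.1] -/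
theorem cleanWindow_of_wallFaceBottom_fit (hs : 0 < s) (hδ : 0 < δ) (hα : Bornology.IsBounded α) (h8 : 8 * δ ≤ s)
    {z : ℤ × ℤ} (hz : WallFaceBottom s α z) {j : ℤ} {m R₁ : ℕ} (h1 : faceA s δ z.1 ≤ j - R₁ - 2)
    (h2 : j + m + R₁ + 2 ≤ faceB s δ z.1) :
    ((zones hs hδ hα).collar.map (Seeded.LatticeSym.reflY.trans (downShift s δ (-z.2 - 1)))).CleanWindow j m R₁ := by
  rw [← Seeded.CollarDatum.map_map, collar_map_reflY]
  exact cleanWindow_of_wallFace_fit hs hδ (isBounded_conj hα) h8 hz.reflect h1 h2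

/-- **Far distance over a lower face.** [cite: SchrammSmirnov2011, §4, proof of Prop. 4.1] -/
theorem le_dist_far_faceBottom (hs : 0 < s) (hδ : 0 < δ) (hδs : δ ≤ s) (hα : Bornology.IsBounded α) {z : ℤ × ℤ}
    (hz : WallFaceBottom s α z) {u : Site 2} (hu : u ∈ (zones hs hδ hα).Far) {x : ℤ} (h1 : faceA s δ z.1 ≤ x)
    (h2 : x ≤ faceB s δ z.1) :
    s / δ - 1 ≤ dist (meshPoint 1 ((Seeded.LatticeSym.reflY.trans (downShift s δ (-z.2 - 1))).σ u)) (meshPoint 1 ![x, 0]) := by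
  have hu' := (mem_Far_reflect hs hδ hα).2 hu
  exact le_dist_far_face hs hδ hδs (isBounded_conj hα) hz.reflect hu' h1 h2

/-! ### Right faces -/

/-- **Clean windows fitting in a right face** (columns `[faceA, faceB]` of `z₂`). [cite: SchrammSmirnov2011, §4, proof of Prop. 4.1] -/
theorem cleanWindow_of_wallFaceRight_fit (hs : 0 < s) (hδ : 0 < δ) (hα : Bornology.IsBounded α) (h8 : 8 * δ ≤ s)
    {z : ℤ × ℤ} (hz : WallFaceRight s α z) {j : ℤ} {m R₁ : ℕ} (h1 : faceA s δ z.2 ≤ j - R₁ - 2)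
    (h2 : j + m + R₁ + 2 ≤ faceB s δ z.2) :
    ((zones hs hδ hα).collar.map (Seeded.LatticeSym.swap.trans (downShift s δ z.1))).CleanWindow j m R₁ := by
  rw [← Seeded.CollarDatum.map_map, collar_map_swap]
  exact cleanWindow_of_wallFace_fit hs hδ (isBounded_swapC hα) h8 hz.swap h1 h2

/-- **Far distance over a right face.** [cite: SchrammSmirnov2011, §4, proof of Prop. 4.1] -/
theorem le_dist_far_faceRight (hs : 0 < s) (hδ : 0 < δ) (hδs : δ ≤ s) (hα : Bornology.IsBounded α) {z : ℤ × ℤ}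
    (hz : WallFaceRight s α z) {u : Site 2} (hu : u ∈ (zones hs hδ hα).Far) {x : ℤ} (h1 : faceA s δ z.2 ≤ x)
    (h2 : x ≤ faceB s δ z.2) :
    s / δ - 1 ≤ dist (meshPoint 1 ((Seeded.LatticeSym.swap.trans (downShift s δ z.1)).σ u)) (meshPoint 1 ![x, 0]) := by
  have hu' := (mem_Far_swap hs hδ hα).2 hu
  exact le_dist_far_face hs hδ hδs (isBounded_swapC hα) hz.swap hu' h1 h2

/-! ### Left faces -/

/-- **Clean windows fitting in a left face** (columns `[faceA, faceB]` of `z₂`). [cite: SchrammSmirnov2011, §4, proof of Prop. 4.1] -/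
theorem cleanWindow_of_wallFaceLeft_fit (hs : 0 < s) (hδ : 0 < δ) (hα : Bornology.IsBounded α) (h8 : 8 * δ ≤ s)
    {z : ℤ × ℤ} (hz : WallFaceLeft s α z) {j : ℤ} {m R₁ : ℕ} (h1 : faceA s δ z.2 ≤ j - R₁ - 2)
    (h2 : j + m + R₁ + 2 ≤ faceB s δ z.2) :
    ((zones hs hδ hα).collar.map
      (Seeded.LatticeSym.swap.trans (Seeded.LatticeSym.reflY.trans (downShift s δ (-z.1 - 1))))).CleanWindow j m R₁ := by
  rw [← Seeded.CollarDatum.map_map, collar_map_swap]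
  exact cleanWindow_of_wallFaceBottom_fit hs hδ (isBounded_swapC hα) h8 hz.swap h1 h2

/-- **Far distance over a left face.** [cite: SchrammSmirnov2011, §4, proof of Prop. 4.1] -/
theorem le_dist_far_faceLeft (hs : 0 < s) (hδ : 0 < δ) (hδs : δ ≤ s) (hα : Bornology.IsBounded α) {z : ℤ × ℤ}
    (hz : WallFaceLeft s α z) {u : Site 2} (hu : u ∈ (zones hs hδ hα).Far) {x : ℤ} (h1 : faceA s δ z.2 ≤ x)
    (h2 : x ≤ faceB s δ z.2) :
    s / δ - 1 ≤ dist (meshPoint 1 ((Seeded.LatticeSym.swap.trans (Seeded.LatticeSym.reflY.trans (downShift s δ (-z.1 - 1)))).σ u))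
      (meshPoint 1 ![x, 0]) := by
  have hu' := (mem_Far_swap hs hδ hα).2 hu
  exact le_dist_far_faceBottom hs hδ hδs (isBounded_swapC hα) hz.swap hu' h1 h2

end CutBlocks

end Literature.Probability.Percolation

end
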